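import Summits.CriticalPhenomena.PercolationContinuityZ3.Theorems.Transplant.HexShadowVSurgeryData
import HarnessLib

/-!
# HEXAGONAL SHADOWS XLV — the local surgery with a cleared VERTEX set (core II: the minimal path of `ω^{(z)}` runs through the rerouted piece)

builds on p205010 (kernel theorem, internal audit signed; external expert review pending) — NOT used in this file.  Lane `prim-bschramm`, seat
`prim-bschramm-p2` (gen 34; class C1b; memo `HOME/bschramm/P2-LATTICES.md` §125); helper file (`--supports stmt-CriticalPhenomena-4575 --as helper`).
«HexShadowSurgeryExchange» VERBATIM for `HexShadow.VSurgery` (cleared vertex set `W` instead of cleared columns `D`): **`VSurgery.exists_tail`** —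
for `ω ∈ 𝒳`, `γ_min(ω^{(z)}) = p₀ ++ E₁ :: P ++ E₂ :: tail`, by the exchange lemma `minSAP_prefix_of_surgery` («MinSAPPrefix»).
[cite: DuminilCopinSidoraviciusTassion2016, §2.3 (proof of Fact 2, p. 7)] [cite: NewmanTassionWu2017, §3.2 (proof of Thm. 3.9)] -/

noncomputable section

namespace Summit.CriticalPhenomena.PercolationContinuityZ3.Theorems.Transplant

open MeasureTheory Literature.Probability.Percolation Literature.Probability.LatticeModels SimpleGraph Filter
open scoped Classical Topology

namespace HexShadow.VSurgery

variable {V : Type} {G : SimpleGraph V} {Φ : HexShadow G} [Countable V] {Γ : GlueData} {ω : BondConfig V}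

/-- The protected structure vertices: all but `w'`. [cite: DuminilCopinSidoraviciusTassion2016, §2.3, proof of Fact 2] -/
def Wv (sg : Φ.VSurgery Γ ω) : Set V := sg.Sw \ {sg.w'}

/-- Protected vertices are structure vertices. [folklore] -/
theorem Wv_subset_Sw (sg : Φ.VSurgery Γ ω) : ∀ ⦃x : V⦄, x ∈ sg.Wv → x ∈ sg.Sw := fun _ h => h.1

/-- New-open edges into protected vertices come from structure vertices, except the two stubs
into `E₁` and `E₂`. [folklore] -/
theorem edge_into_Wv (sg : Φ.VSurgery Γ ω) {t x : V} (h : s(t, x) ∈ sg.newConfig) (hx : x ∈ sg.Wv) :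
    t ∈ sg.Sw ∨ x ∈ ({sg.E₁, sg.E₂} : Set V) := by
  have hxW := sg.Sw_W hx.1
  rcases sg.edge_at_W h hxW with h | h
  · exact Or.inl (sg.structEdges_Sw h).1
  · rcases sg.stubs_cases_W h hxW with ⟨rfl, -⟩ | ⟨rfl, -⟩ | ⟨h1, -⟩
    · exact Or.inr (by simp)
    · exact Or.inr (by simp)
    · exact absurd h1 hx.2

/-- `γ_min(ω)` in decomposed form is an open self-avoiding path. [folklore] -/
theorem γ_openSAP (sg : Φ.VSurgery Γ ω) (hA : ω ∈ Φ.evA Γ) :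
    OpenSAP ω (Φ.lift (Φ.big Γ)) (Φ.lift (Φ.src Γ)) (Φ.lift (Φ.zSeg Γ))
      (sg.p₀ ++ sg.E₁ :: (sg.mid ++ sg.E₂ :: sg.s₀)) := by
  have := (Φ.γmin_spec Γ hA).1
  rwa [sg.hγ] at this

/-- `p₀ ⊆ γ`. [folklore] -/
theorem mem_γ_of_mem_p₀ (sg : Φ.VSurgery Γ ω) {x : V} (hx : x ∈ sg.p₀) : x ∈ Φ.γmin Γ ω := by
  rw [sg.hγ]; exact List.mem_append_left _ hx

/-- `s₀ ⊆ γ`. [folklore] -/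
theorem mem_γ_of_mem_s₀ (sg : Φ.VSurgery Γ ω) {x : V} (hx : x ∈ sg.s₀) : x ∈ Φ.γmin Γ ω := by
  rw [sg.hγ]; simp [hx]

/-- `E₁ ∈ γ`. [folklore] -/
theorem E₁_mem_γ (sg : Φ.VSurgery Γ ω) : sg.E₁ ∈ Φ.γmin Γ ω := by rw [sg.hγ]; simp

/-- `E₂ ∈ γ`. [folklore] -/
theorem E₂_mem_γ (sg : Φ.VSurgery Γ ω) : sg.E₂ ∈ Φ.γmin Γ ω := by rw [sg.hγ]; simp

/-- A structure-path vertex off `P` is `E₁` or `E₂`, hence on `γ`. [folklore] -/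
theorem mem_γ_of_mem_SP_of_not_mem_P (sg : Φ.VSurgery Γ ω) {x : V} (hx : x ∈ sg.SP) (hP : x ∉ sg.P) :
    x ∈ Φ.γmin Γ ω := by
  rcases sg.mem_SP_iff.1 hx with rfl | h | rfl
  · exact sg.E₁_mem_γ
  · exact absurd h hP
  · exact sg.E₂_mem_γ

/-- `p₀` is off the structure. [folklore] -/
theorem p₀_not_Sw (sg : Φ.VSurgery Γ ω) {x : V} (hx : x ∈ sg.p₀) : x ∉ sg.Sw := fun h => sg.hp₀W x hx (sg.Sw_W h)

/-- `s₀` is off the structure. [folklore] -/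
theorem s₀_not_Sw (sg : Φ.VSurgery Γ ω) {x : V} (hx : x ∈ sg.s₀) : x ∉ sg.Sw := fun h => sg.hs₀W x hx (sg.Sw_W h)

/-- The `γ`-edge into `E₁`. [folklore] -/
theorem γ_rel_p₀_E₁ (sg : Φ.VSurgery Γ ω) (hA : ω ∈ Φ.evA Γ) :
    s(sg.p₀.getLast sg.hp₀, sg.E₁) ∈ ω ∧ sg.p₀.getLast sg.hp₀ ≠ sg.E₁ := by
  have hch := (sg.γ_openSAP hA).chain
  exact (List.isChain_append.1 hch).2.2 (sg.p₀.getLast sg.hp₀)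
    (by rw [List.getLast?_eq_some_getLast sg.hp₀]; rfl) sg.E₁ (by simp)

/-- The `γ`-edge out of `E₂`. [folklore] -/
theorem γ_rel_E₂_s₀ (sg : Φ.VSurgery Γ ω) (hA : ω ∈ Φ.evA Γ) :
    s(sg.E₂, sg.s₀.head sg.hs₀) ∈ ω ∧ sg.E₂ ≠ sg.s₀.head sg.hs₀ := by
  have hch := (sg.γ_openSAP hA).chain
  have h1 := (List.isChain_append.1 hch).2.1
  rw [List.isChain_cons] at h1
  have h3 := (List.isChain_append.1 h1.2).2.1
  rw [List.isChain_cons] at h3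
  exact h3.1 (sg.s₀.head sg.hs₀) (by rw [List.head?_eq_some_head sg.hs₀]; rfl)

/-- The chain of `γ` on `s₀`. [folklore] -/
theorem γ_chain_s₀ (sg : Φ.VSurgery Γ ω) (hA : ω ∈ Φ.evA Γ) : sg.s₀.IsChain (fun a b => s(a, b) ∈ ω ∧ a ≠ b) := by
  have hch := (sg.γ_openSAP hA).chain
  have h1 := (List.isChain_append.1 hch).2.1
  rw [List.isChain_cons] at h1
  have h3 := (List.isChain_append.1 h1.2).2.1
  rw [List.isChain_cons] at h3
  exact h3.2

/-- The head of `γ` is the head of `p₀`. [folklore] -/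
theorem γ_head? (sg : Φ.VSurgery Γ ω) : (Φ.γmin Γ ω).head? = some (sg.p₀.head sg.hp₀) := by
  rw [sg.hγ, List.head?_append, List.head?_eq_some_head sg.hp₀]; rfl

/-- `γ` starts in `S̄_{3n}`. [folklore] -/
theorem p₀_head_mem_src (sg : Φ.VSurgery Γ ω) (hA : ω ∈ Φ.evA Γ) : sg.p₀.head sg.hp₀ ∈ Φ.lift (Φ.src Γ) := by
  have h := (sg.γ_openSAP hA).head_mem (by simp)
  rwa [List.head_append_of_ne_nil sg.hp₀] at h

/-- `γ` ends in `Z̄_n`. [folklore] -/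
theorem s₀_last_mem_Y (sg : Φ.VSurgery Γ ω) (hA : ω ∈ Φ.evA Γ) : sg.s₀.getLast sg.hs₀ ∈ Φ.lift (Φ.zSeg Γ) := by
  have h := (sg.γ_openSAP hA).last_mem (by simp)
  rwa [List.getLast_append_of_ne_nil _ (by simp), List.getLast_cons (by simp),
    List.getLast_append_of_ne_nil _ (by simp), List.getLast_cons sg.hs₀] at h

/-- An `ω`-open pair with both endpoints off `W` stays open. [folklore] -/
theorem mem_newConfig_of_off (sg : Φ.VSurgery Γ ω) {a b : V} (hab : s(a, b) ∈ ω) (ha : a ∉ sg.W)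
    (hb : b ∉ sg.W) : s(a, b) ∈ sg.newConfig :=
  (sg.mem_newConfig_iff_of_not_touch (by simp [ha, hb])).2 hab

/-- Structure edges are new-open. [folklore] -/
theorem structEdges_sub_newConfig (sg : Φ.VSurgery Γ ω) : ∀ ⦃e : Sym2 V⦄, e ∈ sg.structEdges → e ∈ sg.newConfig := fun _ h => Or.inl (Or.inr h)

/-- Stubs are new-open. [folklore] -/
private theorem stubs_subset_newConfig (sg : Φ.VSurgery Γ ω) : sg.stubs ⊆ sg.newConfig := fun _ h => Or.inr h

/-- The stub into `E₁` is new-open. [folklore] -/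
private theorem stub₁_mem (sg : Φ.VSurgery Γ ω) : s(sg.p₀.getLast sg.hp₀, sg.E₁) ∈ sg.newConfig :=
  sg.stubs_subset_newConfig (Or.inl (by simp))

/-- The stub out of `E₂` is new-open. [folklore] -/
private theorem stub₂_mem (sg : Φ.VSurgery Γ ω) : s(sg.E₂, sg.s₀.head sg.hs₀) ∈ sg.newConfig :=
  sg.stubs_subset_newConfig (Or.inl (by simp))

/-- The stub out of `w'` is new-open. [folklore] -/
theorem stub₃_mem (sg : Φ.VSurgery Γ ω) {w₂ : V} (h : w₂ ∈ sg.σ.tail.head?) : s(sg.w', w₂) ∈ sg.newConfig :=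
  sg.stubs_subset_newConfig (Or.inr ⟨w₂, h, rfl⟩)

/-- The rerouted path `T = p₀ ++ E₁ :: P ++ E₂ :: s₀`. [cite: DuminilCopinSidoraviciusTassion2016, §2.3, proof of Fact 2] -/
abbrev T (sg : Φ.VSurgery Γ ω) : List V := sg.p₀ ++ (sg.SP ++ sg.s₀)

/-- The structure path ends at `E₂`. [folklore] -/
private theorem SP_getLast? (sg : Φ.VSurgery Γ ω) : sg.SP.getLast? = some sg.E₂ := by
  simp [SP, List.getLast?_eq_some_getLast]

/-- **`T` is an open self-avoiding path of `ω^{(z)}` from `S̄_{3n}` to `Z̄_n` inside `B̄_{3n}`.**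
[cite: DuminilCopinSidoraviciusTassion2016, §2.3, proof of Fact 2] -/
theorem openSAP_T (sg : Φ.VSurgery Γ ω) (hA : ω ∈ Φ.evA Γ) :
    OpenSAP sg.newConfig (Φ.lift (Φ.big Γ)) (Φ.lift (Φ.src Γ)) (Φ.lift (Φ.zSeg Γ)) sg.T := by
  have hγO := sg.γ_openSAP hA
  have hγnd := hγO.nodup
  rw [List.nodup_append] at hγnd
  obtain ⟨hp₀nd, hrestnd, hp₀rest⟩ := hγnd
  have hs₀nd : sg.s₀.Nodup :=
    (List.nodup_cons.1 (List.nodup_append.1 (List.nodup_cons.1 hrestnd).2).2.1).2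
  have hγch := hγO.chain
  refine ⟨?_, ?_, ?_, by simp [T, sg.hp₀], ?_, ?_⟩
  · -- nodup
    rw [List.nodup_append, List.nodup_append]
    refine ⟨hp₀nd, ⟨sg.hSPnodup, hs₀nd, fun a ha b hb hab => ?_⟩, fun a ha b hb hab => ?_⟩
    · exact sg.hs₀W b hb (hab ▸ sg.SP_W ha)
    · rcases List.mem_append.1 hb with hb | hb
      · exact sg.hp₀W a ha (hab.symm ▸ sg.SP_W hb)
      · exact hp₀rest a ha b (by simp [hb]) hab
  · -- chain
    refine List.IsChain.append ?_ (List.IsChain.append ?_ ?_ ?_) ?_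
    · exact (List.isChain_append.1 hγch).1.imp_of_mem_imp fun a b ha hb h =>
        ⟨sg.mem_newConfig_of_off h.1 (sg.hp₀W a ha) (sg.hp₀W b hb), h.2⟩
    · exact isChain_of_edgesOf_subset sg.hSPchain
        (fun e he => sg.structEdges_sub_newConfig (Or.inl he))
    · exact (sg.γ_chain_s₀ hA).imp_of_mem_imp fun a b ha hb h =>
        ⟨sg.mem_newConfig_of_off h.1 (sg.hs₀W a ha) (sg.hs₀W b hb), h.2⟩
    · intro x hx y hy
      rw [sg.SP_getLast?, Option.mem_def, Option.some.injEq] at hx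
      rw [List.head?_eq_some_head sg.hs₀, Option.mem_def, Option.some.injEq] at hy
      subst hx; subst hy
      exact ⟨sg.stub₂_mem, (sg.γ_rel_E₂_s₀ hA).2⟩
    · intro x hx y hy
      rw [List.getLast?_eq_some_getLast sg.hp₀, Option.mem_def, Option.some.injEq] at hx
      have : y = sg.E₁ := by
        simp only [SP, List.cons_append, List.head?_cons, Option.mem_def, Option.some.injEq] at hy
        exact hy.symm
      subst hx; subst this
      exact ⟨sg.stub₁_mem, (sg.γ_rel_p₀_E₁ hA).2⟩
  · -- inside `B̄_{3n}`
    intro x hx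
    rcases List.mem_append.1 hx with hx | hx
    · exact HexShadow.Surgery.γ_subset_big hA (sg.mem_γ_of_mem_p₀ hx)
    rcases List.mem_append.1 hx with hx | hx
    · rcases sg.mem_SP_iff.1 hx with rfl | h | rfl
      · exact HexShadow.Surgery.γ_subset_big hA sg.E₁_mem_γ
      · exact sg.hPbig x h
      · exact HexShadow.Surgery.γ_subset_big hA sg.E₂_mem_γ
    · exact HexShadow.Surgery.γ_subset_big hA (sg.mem_γ_of_mem_s₀ hx)
  · -- starts in `S̄_{3n}`
    intro h
    have : (sg.p₀ ++ (sg.SP ++ sg.s₀)).head h = sg.p₀.head sg.hp₀ :=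
      List.head_append_of_ne_nil sg.hp₀
    rw [this]
    exact sg.p₀_head_mem_src hA
  · -- ends in `Z̄_n`
    intro h
    have : (sg.p₀ ++ (sg.SP ++ sg.s₀)).getLast h = sg.s₀.getLast sg.hs₀ := by
      rw [List.getLast_append_of_ne_nil _ (by simp [sg.hs₀]),
        List.getLast_append_of_ne_nil _ sg.hs₀]
    rw [this]
    exact sg.s₀_last_mem_Y hA

/-- `σ = w' :: σ.tail`. [folklore] -/
theorem σ_eq_cons (sg : Φ.VSurgery Γ ω) : sg.σ = sg.w' :: sg.σ.tail := by
  conv_lhs => rw [← List.cons_head_tail sg.σ_ne_nil]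
  rw [sg.σ_head]

/-- Along `σ`, `w'` is `ω`-joined inside `B̄'_n` to a vertex of `S̄'_n`. [folklore] -/
theorem w'_joined_src' (sg : Φ.VSurgery Γ ω) : ∃ s' ∈ Φ.lift (Φ.src' Γ), ω ∈ openConnIn (Φ.lift (Φ.small Γ)) sg.w' s' := by
  have hch := sg.hσchain
  rw [sg.σ_eq_cons] at hch
  refine ⟨(sg.w' :: sg.σ.tail).getLast (List.cons_ne_nil _ _), ?_, ?_⟩
  · have := sg.hσsrc' sg.σ_ne_nil
    convert this using 1
    exact (List.getLast_congr _ _ sg.σ_eq_cons).symm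
  · exact openConnIn_of_isChain' _ _ hch fun x hx => sg.hσsmall x (by rw [sg.σ_eq_cons]; exact hx)

/-- `w'` is not `ω`-joined to `S̄_{3n}` inside `B̄_{3n} ∪ B̄'_n` (else `C(ω)`). [cite: DuminilCopinSidoraviciusTassion2016, §2.3, proof of Fact 2] -/
theorem w'_not_joined (sg : Φ.VSurgery Γ ω) (hX : ω ∈ Φ.evX Γ) {x : V} (hx : x ∈ Φ.lift (Φ.src Γ))
    (h : ω ∈ openConnIn (Φ.lift (Φ.big Γ ∪ Φ.small Γ)) x sg.w') : False := by
  obtain ⟨-, hC⟩ := hX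
  obtain ⟨s', hs', hj⟩ := sg.w'_joined_src'
  exact hC ⟨x, hx, s', hs', SlabCriticality.openConnIn_trans h
    (openConnIn_mono (Φ.lift_mono Set.subset_union_right) _ _ hj)⟩

/-- Membership in `Br` other than at `w'` means membership in `Br.dropLast`. [folklore] -/
theorem mem_dropLast_of_ne (sg : Φ.VSurgery Γ ω) {x : V} (hx : x ∈ sg.Br) (hne : x ≠ sg.w') : x ∈ sg.Br.dropLast := by
  have := List.dropLast_concat_getLast sg.hBr
  rw [← this] at hx
  rcases List.mem_append.1 hx with h | h
  · exact h
  · simp only [List.mem_singleton] at h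
    exact absurd h hne

/-- **The minimal path of `ω^{(z)}` runs through the rerouted piece**: `γ_min(ω^{(z)}) = p₀ ++ E₁ :: P ++ E₂ :: tail` for some `tail` (DST: "`γ_min(ω^{(z)})` and
`γ_min(ω)` coincide at least until `u'` … forces it to go inside `B̄_R(z)` … it must contain `z`"), by the exchange lemma `minSAP_prefix_of_surgery`. [cite:
DuminilCopinSidoraviciusTassion2016, §2.3, proof of Fact 2 (p. 7)] -/
theorem exists_tail (sg : Φ.VSurgery Γ ω) (hX : ω ∈ Φ.evX Γ) : ∃ tail, Φ.γmin Γ sg.newConfig = sg.p₀ ++ (sg.SP ++ tail) := by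
  have hA := HexShadow.evA_of_evX hX
  have hS := Φ.lift_big_finite Γ
  have hex : ∃ l, OpenSAP ω (Φ.lift (Φ.big Γ)) (Φ.lift (Φ.src Γ)) (Φ.lift (Φ.zSeg Γ)) l :=
    (mem_openCrossing_iff_exists_openSAP ω _ _ _).1 hA
  have hγ' : minSAP ω (Φ.lift (Φ.big Γ)) (Φ.lift (Φ.src Γ)) (Φ.lift (Φ.zSeg Γ)) =
      (sg.p₀ ++ [sg.E₁]) ++ (sg.mid ++ sg.E₂ :: sg.s₀) := by
    rw [List.append_assoc]; exact sg.hγ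
  have hT : OpenSAP sg.newConfig (Φ.lift (Φ.big Γ)) (Φ.lift (Φ.src Γ)) (Φ.lift (Φ.zSeg Γ))
      ((sg.p₀ ++ [sg.E₁]) ++ (sg.P ++ [sg.E₂]) ++ sg.s₀) := by
    have := sg.openSAP_T hA
    convert this using 1
    simp [T, SP]
  have hγeq : minSAP ω (Φ.lift (Φ.big Γ)) (Φ.lift (Φ.src Γ)) (Φ.lift (Φ.zSeg Γ)) = Φ.γmin Γ ω := rfl
  have hpfx : ∀ x ∈ (sg.p₀ ++ [sg.E₁]).dropLast, x ∉ sg.Sw := by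
    intro x hx
    rw [List.dropLast_concat] at hx
    exact sg.p₀_not_Sw hx
  have h2 : ∀ q x, s(q, x) ∈ sg.newConfig → x ∈ sg.Wv →
      x ∉ minSAP ω (Φ.lift (Φ.big Γ)) (Φ.lift (Φ.src Γ)) (Φ.lift (Φ.zSeg Γ)) → q ∈ sg.Sw := by
    intro q x hqx hxW hxγ
    rcases sg.edge_into_Wv hqx hxW with h | h
    · exact h
    · exfalso
      rcases h with rfl | rfl
      · exact hxγ sg.E₁_mem_γ
      · exact hxγ sg.E₂_mem_γ
  have h4 : ∀ q ∈ sg.Sw, q ∉ sg.Wv →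
      q ∉ minSAP ω (Φ.lift (Φ.big Γ)) (Φ.lift (Φ.src Γ)) (Φ.lift (Φ.zSeg Γ)) →
      ∀ x ∈ Φ.lift (Φ.src Γ), ω ∉ openConnIn (Φ.lift (Φ.big Γ)) x q := by
    intro q hq hqW _ x hx hj
    have hqw : q = sg.w' := by
      by_contra hne
      exact hqW ⟨hq, hne⟩
    subst hqw
    exact sg.w'_not_joined hX hx (openConnIn_mono (Φ.lift_mono Set.subset_union_left) _ _ hj)
  have h5 : ∀ v ∈ sg.Wv, v ∈ Φ.lift (Φ.src Γ) →
      v ∈ minSAP ω (Φ.lift (Φ.big Γ)) (Φ.lift (Φ.src Γ)) (Φ.lift (Φ.zSeg Γ)) ∨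
      ∀ b ∈ (minSAP ω (Φ.lift (Φ.big Γ)) (Φ.lift (Φ.src Γ)) (Φ.lift (Φ.zSeg Γ))).head?,
        vtxKey V b ≤ vtxKey V v := by
    intro v hvW hvX
    rw [hγeq]
    by_cases hvγ : v ∈ Φ.γmin Γ ω
    · exact Or.inl hvγ
    · right
      obtain ⟨hvSw, hvw⟩ := hvW
      have hv' : v ∈ sg.P ++ sg.Br.dropLast := by
        rcases hvSw with h | h
        · rcases sg.mem_SP_iff.1 h with rfl | h | rfl
          · exact absurd sg.E₁_mem_γ hvγ
          · exact List.mem_append_left _ h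
          · exact absurd sg.E₂_mem_γ hvγ
        · exact List.mem_append_right _ (sg.mem_dropLast_of_ne h hvw)
      exact sg.hsrc v hv' hvX hvγ
  have h9 : ∀ x ∈ (sg.P ++ [sg.E₂]).dropLast, x ∉ Φ.lift (Φ.zSeg Γ) := by
    intro x hx
    rw [List.dropLast_concat] at hx
    exact sg.hPY x hx
  have h6 : ∀ (p₁ : List V) (x y : V) (r : List V),
      (sg.p₀ ++ [sg.E₁]) ++ (sg.P ++ [sg.E₂]) = p₁ ++ x :: y :: r →
      (sg.p₀ ++ [sg.E₁]).length ≤ p₁.length + 1 →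
      ∀ q, s(x, q) ∈ sg.newConfig → q ≠ y → q ∈ p₁ ∨ vtxKey V y < vtxKey V q := by
    intro p₁ x y r heq hlen q hxq hqy
    have heq' : sg.p₀ ++ sg.SP = p₁ ++ x :: y :: r := by
      rw [← heq]; simp [SP]
    have hlen' : sg.p₀.length ≤ p₁.length := by simpa using hlen
    obtain ⟨p₁', hp₁, hSP⟩ : ∃ p₁', p₁ = sg.p₀ ++ p₁' ∧ sg.SP = p₁' ++ x :: y :: r := by
      rcases List.append_eq_append_iff.1 heq' with ⟨a', hp₁, hSP⟩ | ⟨c', hp₀, hxyr⟩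
      · exact ⟨a', hp₁, hSP⟩
      · -- `p₀ = p₁ ++ c'` forces `c' = []`
        have : c' = [] := by
          have := congrArg List.length hp₀
          simp only [List.length_append] at this
          exact List.eq_nil_of_length_eq_zero (by omega)
        subst this
        simp only [List.append_nil] at hp₀
        simp only [List.nil_append] at hxyr
        exact ⟨[], by simp [hp₀], by simpa using hxyr.symm⟩
    have hxSP : x ∈ sg.SP := by rw [hSP]; simp
    have hxD : x ∈ sg.W := sg.SP_W hxSP
    have hxq' : s(q, x) ∈ sg.newConfig := by rwa [Sym2.eq_swap]
    have hcases : s(x, q) ∈ sg.structEdges ∨ s(x, q) ∈ sg.stubs := by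
      have := sg.edge_at_W hxq' hxD
      rwa [Sym2.eq_swap] at this
    rcases hcases with (he | he) | he
    · -- an edge of `SP`: to the predecessor (`∈ p₁`) or the successor (`= y`)
      rcases next_of_mem_edgesOf sg.hSPnodup hSP he with ⟨r', hr'⟩ | ⟨l₁', hl₁'⟩
      · exact absurd (List.cons.inj hr').1.symm hqy
      · left
        rw [hp₁, hl₁']
        simp
    · -- an edge of the branch: `x = c` and `q = Br.head`
      obtain ⟨hxBr, hqBr⟩ := mem_of_mem_edgesOf he
      have hxc : x = sg.c := by
        rcases List.mem_cons.1 hxBr with h | h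
        · exact h
        · exact absurd hxSP (sg.hBrSP x h)
      subst hxc
      obtain ⟨l', hl'⟩ := eq_of_mem_edgesOf_head sg.hBrnodup he
      right
      have hq : q = sg.Br.head sg.hBr := by simp [hl']
      rw [hq]
      exact sg.hfwd p₁' r y hSP
    · -- a stub at `x ∈ SP`: only the one into `E₁`, from `p₀.getLast ∈ p₁`
      have he' : s(q, x) ∈ sg.stubs := by rwa [Sym2.eq_swap]
      rcases sg.stubs_cases_W he' hxD with ⟨-, rfl⟩ | ⟨hxE₂, -⟩ | ⟨hxw, -⟩
      · left
        rw [hp₁]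
        exact List.mem_append_left _ (List.getLast_mem _)
      · -- `x = E₂` is the last vertex of `SP`, but `y` follows it
        exfalso
        have h1 : sg.SP = (sg.E₁ :: sg.P) ++ sg.E₂ :: [] := by simp [SP]
        rw [hxE₂] at hSP
        have hE₂p : sg.E₂ ∉ p₁' := by
          intro hmem
          have hnd := sg.hSPnodup
          rw [show sg.E₁ :: (sg.P ++ [sg.E₂]) = sg.SP from rfl, hSP] at hnd
          exact (List.nodup_append.1 hnd).2.2 _ hmem _ (by simp) rfl
        have hE₂q : sg.E₂ ∉ sg.E₁ :: sg.P := by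
          intro hmem
          have hnd := sg.hSPnodup
          rw [show sg.E₁ :: (sg.P ++ [sg.E₂]) = (sg.E₁ :: sg.P) ++ [sg.E₂] by simp] at hnd
          exact (List.nodup_append.1 hnd).2.2 _ hmem _ (by simp) rfl
        obtain ⟨-, h2⟩ := split_unique (hSP.symm.trans h1) hE₂p hE₂q
        exact List.cons_ne_nil _ _ h2
      · exact absurd hxSP (hxw ▸ sg.w'_facts.2.2.2)
  obtain ⟨tail, htail⟩ := minSAP_prefix_of_surgery hS hex (sg.p₀ ++ [sg.E₁])
    (sg.mid ++ sg.E₂ :: sg.s₀) (sg.P ++ [sg.E₂]) sg.s₀ hγ' (by simp) (by simp) hT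
    sg.structEdges sg.Wv sg.Sw (sg.newConfig_subset hA) (fun a b h => sg.structEdges_Sw h)
    hpfx h2 h4 h5 h6 h9
  refine ⟨tail, ?_⟩
  change minSAP sg.newConfig _ _ _ = _
  rw [htail]; simp [SP]

end HexShadow.VSurgery

end Summit.CriticalPhenomena.PercolationContinuityZ3.Theorems.Transplant

end
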